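import Mathlib.Analysis.Matrix.Spectrum
import Mathlib.Analysis.InnerProductSpace.PiL2
import Mathlib.LinearAlgebra.StdBasis
import Mathlib.LinearAlgebra.Matrix.ToLin
import Mathlib.Data.Finset.Sort
import Mathlib.Order.LiminfLimsup
import Literature.Dynamics.Billiards.PesinDefectDensity
import HarnessLib

/-!
# The infinite hard-sphere gas: positive-Lyapunov density, collision charge and the
# Pesin defect per particle

Topic `Literature/Dynamics/Billiards`; definition request `defn-InfiniteVolumePesinDefect` of route
`Summits/AtomisticToContinuum/HydrodynamicLimit/Theses/PesinPricing.lean` (cruxes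
`KiferYoungUpperR`, stmt-AtomisticToContinuum-13790, and `PesinSaturationRigidity`, stmt-13806):
the infinite-volume half that `Literature.Dynamics.Billiards.PesinDefectDensity` deferred — the
positive-Lyapunov (unstable-Jacobian) DENSITY `λ⁺(P)` of a law `P` on configurations of the
infinite gas and the defect `i(P) = (λ⁺(P) - h(P)) / ρ(P)` per particle per unit (microscopic)
time, `h = entropyDensity` (space-time entropy density, already in the tree), `ρ = intensity`.

## Content

1. **Linearised hard-sphere dynamics** (Gaspard 1998 §1.4.4–1.4.5; in the fixed-time form of
   Dellago–Posch–Hoover, Phys. Rev. E 53 (1996) 1485). Tangent vectors of one particle are pairs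
   `(δx, δv) ∈ ℝ^d × ℝ^d`. Free flight of duration `τ` is the shear
   `freeFlightTangent τ (δx, δv) = (δx + τ δv, δv)` (Gaspard (1.108)).
   A binary elastic collision of equal masses with separation `n = x_p - x_q` (`‖n‖ = ε`) and
   INCOMING relative velocity `g = v_p⁻ - v_q⁻` acts on the pair `((δx_p, δv_p), (δx_q, δv_q))` by
   (`δx = δx_p - δx_q`, `δv = δv_p - δv_q`, `P_n w = (⟪n, w⟫/‖n‖²) n`)
   `δx_p' = δx_p - P_n δx`, `δv_p' = δv_p - P_n δv - (⟪g, c⟫ n + ⟪n, g⟫ c)/‖n‖²`,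
   `c = δx - (⟪n, δx⟫/⟪n, g⟫) g` the displacement of the impact point (collision-time shift
   `δt = -⟪n, δx⟫/⟪n, g⟫`), and symmetrically for `q` — `collisionTangent n g` returns the
   `p`-component; this is Gaspard's (1.112) `δv⁺ = δv⁻ - 2(N·δv⁻)N - 2(N·V⁻) K δq - 2(V⁻·K δq) N`
   for the billiard `‖x_p - x_q‖ ≥ ε` in `ℝ^{2d}` (unit normal `N = (n̂, -n̂)/√2`, second
   fundamental form `K = ε⁻¹ (1 - n̂ n̂ᵀ) ⊗ [[1,-1],[-1,1]]/√2`), written per particle.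
2. **The frozen-exterior tangent map of the infinite gas.** For a family of particle paths
   `x p : ℝ → ℝ^d × ℝ^d` labelled by `p ∈ S` (in the flow: `S = ω`, `x = Φ.traj ω`), a finite set
   `I` of TAGGED particles and a time `t`, `taggedTangentMap ε S x I t : (I → ℝ^d × ℝ^d) →ₗ (I → …)`
   is the derivative at the unperturbed data of "displace the tagged particles, let every other
   particle move on its given path": the time-ordered product, over the collision instants in
   `(0, t]` of tagged particles (`collisionInstants`), of free-flight shears and of the collision
   maps `instantTangent` (a tagged partner enters with its own perturbation, an untagged partner
   with perturbation `0`, and the perturbation imparted to untagged partners is discarded). It is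
   read off the trajectory alone: partners and separations from `collisionEvents`, incoming
   velocities from the outgoing (right-continuous) ones by the involution `reflectVel`.
3. **Finite-time volume growth.** `logVolGrowth A = ∑ᵢ log⁺ sᵢ(A)` (singular values; `= ½ ∑ log⁺`
   of the eigenvalues of `Aᴴ A`, `Matrix.IsHermitian.eigenvalues`) — the maximal logarithmic volume
   expansion of `A` over all subspaces; for the derivative cocycle of a finite-dimensional system
   `n⁻¹ ∑ᵢ log⁺ sᵢ(D f^n (x)) → ∑_{χᵢ > 0} kᵢ χᵢ` at regular points (Barreira–Pesin 2023 Thm. 3.12),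
   the integrand of Ruelle's inequality (Thm. 9.22). `linGrowth M` applies it to the matrix
   of `M` in the coordinates `(δxᵢ, δvᵢ)_{i ∈ I}` (`tangentBasis`).
4. **The positive-Lyapunov density.** `finiteTimeGrowth Φ ω B t = ∑ log⁺ sᵢ` of the frozen-exterior
   tangent map over `[0, t]` of the particles of `ω` initially in the window `B`;
   `growthDensity Φ ω t = limsup_L L^{-d} finiteTimeGrowth Φ ω [0,L)^d t` (thermodynamic limit at
   FIXED time); `posLyapAt Φ ω = inf_n n⁻¹ growthDensity Φ ω n` (then the time rate);
   `posLyapDensity Φ P = ∫ posLyapAt Φ ω P(dω) ∈ [0, ∞]` — positive Lyapunov exponents per unit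
   time per unit volume. PROVED: it is affine in `P` (`posLyapDensity_add_measure`,
   `posLyapDensity_smul_measure`), and the vacuum has density `0` (`posLyapAt_empty`).
5. **The collision-charge (clock) density** of the route (`UpperVolumeLemma`'s charge `Λ` at
   `ε = 1`, per unit volume): `clockCharge Φ ω = ∑` over collision events `(p, s)` of `ω`
   (`collisionEvents`; two events per binary collision, one per partner, the convention of
   `collisionIntensity`) with `s ∈ [0, 1)` and `x_p(s) ∈ [0,1)^d` of `log (1 + ‖g‖ τ⁺)`, `g` the
   relative velocity of the pair, `τ⁺ = nextCollisionGap` the time to the next collision of either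
   partner (van Zon–van Beijeren–Dellago 1998: in the dilute gas a perturbation `δv` acquired in a
   collision grows into `δx ≈ τ δv` before it is read by the next one, `‖δv'‖ ≈ (‖g‖ τ / ε) ‖δv‖`);
   `clockChargeDensity Φ P = ∫ clockCharge dP`. Pathwise, no tangent dynamics; no comparison with
   `posLyapDensity` is claimed.
6. **Defect densities.** `pesinDefectDensity Φ P = posLyapDensity Φ P - entropyDensity Φ P` (per
   unit time per unit volume, truncated subtraction in `ℝ≥0∞`) and the defect PER PARTICLE per
   unit microscopic time `infPesinDefect Φ P = pesinDefectDensity Φ P / intensity P` — the rate `i`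
   of the cruxes. For the `ε⁻¹`-blow-up of `N+1` spheres of diameter `ε = σ (N+1)^{-1/3}` on `𝕋³`
   (periodised, microscopic units: intensity `(N+1) ε³ = σ³`, rates `× ε`, volume `ε⁻³`) this
   normalisation is `ε⁴ · pesinDefect / σ³ = σ · pesinDefectPerCollision` of the finite file.

## Design choices

* *Order of limits (why not Lyapunov exponents of a fixed box).* The request's candidate (a1) —
  Lyapunov exponents (`n → ∞`) of the tangent dynamics of the particles of a FIXED box in the
  unperturbed environment, then box `→ ∞` — does not give the density of `∑λ⁺`: as `n → ∞` the
  tagged particles disperse into the bath and the exponents of the restricted cocycle are those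
  of tracers among unperturbed scatterers, which sit at the top of the many-particle spectrum
  (Gaspard–van Beijeren, J. Stat. Phys. 109 (2002) "When do tracer particles dominate the Lyapunov
  spectrum?"; van Zon–van Beijeren–Dellago 1998), so box-after-time overcounts. Here the
  thermodynamic limit is taken at FIXED time on the finite-time functional `∑ log⁺ sᵢ` (for which
  the frozen boundary is a surface effect, `O(t L^{d-1})` tagged–untagged collisions against
  `O(L^d)`), and the time rate last — the order used for Lyapunov spectra of spatially extended
  systems (Ruelle, Comm. Math. Phys. 87 (1982) 287–302; Livi–Politi–Ruffo, J. Phys. A 19 (1986)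
  2033; Sinai, Int. J. Bifurcation Chaos 6 (1996) 1137–1142; densities of entropy / exponents for
  coupled map lattices: Bricmont–Kupiainen 1996). Candidate (a2)
  (log-Jacobian along local unstable plaques) needs the plaque functor of the not yet delivered
  `defn-InfiniteUnstablePlaques` and is not used.
* `inf` over times (the functional is subadditive along a cocycle, so `inf = lim` of `n⁻¹ ·` for
  stationary data up to the vanishing boundary layer; the convention of `Ergodic.dynEntropy` and
  `spaceTimeEntropyRate`), `limsup` over boxes (upper density, the convention of `lyapExponent`);
  pathwise first, then `∫ dP`, so that `λ⁺` is manifestly affine (H4) and lower-integral valued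
  (no measurability presupposed, as `meanPosLyapSum`). Integer times `n + 1 ≥ 1` (at `n = 0` the
  rate would read `0⁻¹ · 0`). Boxes `[0, L)^d`, `L ∈ ℕ`, as the lattice boxes of `entropyDensity`.
* Singular values are taken in the Euclidean structure of the coordinates `(δxᵢ, δvᵢ)ᵢ`; another
  inner product changes `∑ log⁺ sᵢ` by `O(dim) = O(L^d)` uniformly in time, invisible after `n⁻¹`.
* Junk values (documented at each definition): `collisionTangent` divides by `⟪n, g⟫` and `‖n‖²`
  (`x/0 = 0`: grazing or coincident data give a partial map); `taggedTangentMap` is `0` if the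
  tagged particles have infinitely many collision instants in `(0, t]`, `finiteTimeGrowth` is `⊤`
  if infinitely many particles start in the window (neither happens for a good configuration of an
  `InfiniteHardSphereFlow` and a bounded window); `nextCollisionGap` is `0` (no charge) if neither
  partner ever collides again; `infPesinDefect` inherits `∞ - ∞ = 0`, `x / 0 = ∞ (x ≠ 0)`,
  `x / ∞ = 0` from `ℝ≥0∞` (`infPesinDefect_eq_zero_iff`). Simultaneous collisions of disjoint
  tagged pairs at one instant are handled by `instantTangent` particle-wise (no ordering needed);
  two partners of one particle at one instant are excluded by
  `IsInfiniteHardSphereTrajectory.binary`.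
* NOT HERE — claims the route uses about these objects, for which NO printed source exists in
  infinite volume (they are route items of `PesinPricing`, to be filed on the Summits side; typed
  shapes for `Φ : InfiniteHardSphereFlow (Fin 3) 1`, `P` with `IsTranslationInvariant P`,
  `Φ.IsAEDefined P`, `Φ.IsStationary P`, `intensity P < ∞`, `kineticEnergyDensity P < ∞`):
  **H0** (density Ruelle inequality, shape of Barreira–Pesin Thm. 9.22 / Katok–Strelcyn for maps
  with singularities) `entropyDensity Φ P ≤ posLyapDensity Φ P`;
  **H1** (Pesin formula for the equilibrium gas, shape of Ledrappier–Young 1985 Thm. A /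
  Barreira–Pesin Thm. 9.27; Sinai–Chernov 1982/1986 prove, at small density and zero drift, that
  the thermodynamic limit of `h(Φ¹_N)/N` exists and is the space-time entropy per particle —
  Wojtkowski 1988 p. 133 — the drift `u ≠ 0` and the identification with THIS `λ⁺` are not in print)
  `∀ z β u, 0 < z → 0 < β → IsHardSphereGibbs 1 z β u P → infPesinDefect Φ P = 0`;
  **H2** (Galilean invariance) `infPesinDefect Φ (P.map (PointConfig.translate (0, u))) =
  infPesinDefect Φ P` (needs Galilean covariance of `Φ`, not a field of the structure);
  **H3** (1-homogeneity at fixed time unit) under `(x, v) ↦ (x, α v)`, `α > 0`: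
  `(h, λ⁺, i) ↦ α · (h, λ⁺, i)` (needs the scaling covariance `Φ_t ∘ S_α = S_α ∘ Φ_{α t}`);
  **H4** `i · ρ` affine on translation-invariant stationary laws: the `λ⁺` half is
  `posLyapDensity_add_measure` here, the `h` half is affinity of the entropy of a `ℤ^{1+d}`-action
  (Keller 1998 Thm. 3.3.2 for `ℤ^d₊`-actions; not yet in the tree for `spaceTimeEntropy`);
  **H5** `h` upper semicontinuous in the local weak topology (needs `defn-PalmLocalState`).
  Also not here: existence of the limits replacing `limsup`/`inf`, measurability of `posLyapAt`,
  and any comparison `clockChargeDensity ≍ posLyapDensity` (dilute-gas clock model, heuristic).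

## References

* P. Gaspard, *Chaos, Scattering and Statistical Mechanics* (1998), §1.4.3–1.4.5, eqs. (1.106),
  (1.108)–(1.109) (free flight), (1.110), (1.112) (collision), pp. 33–35 [Gaspard1998].
* P. Gaspard, *The Statistical Mechanics of Irreversible Phenomena* (2022), App. B.3,
  (B.35)–(B.40) (binary collision rule of hard balls) [Gaspard2022].
* L. Barreira, Ya. Pesin, *Introduction to Smooth Ergodic Theory*, 2nd ed. (2023), §2.1.2 (2.3)
  (multiplicities), Thm. 3.12 (volume growth rates at regular points), Thm. 9.22 (Ruelle's
  inequality), Thm. 9.27 (entropy formula) [BarreiraPesin2023].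
* F. Ledrappier, L.-S. Young, Ann. of Math. 122 (1985), Thm. A [LedrappierYoung1985].
* Ya. G. Sinai, N. I. Chernov, Trudy Sem. Petrovsk. 8 (1982) 218–238 = J. Soviet Math. 32 (1986)
  389–406 [SinaiChernov1986], as quoted by M. Wojtkowski, ETDS 8 (1988), p. 133 [Wojtkowski1988].
* R. van Zon, H. van Beijeren, Ch. Dellago, PRL 80 (1998) 2035 [VanzonVanbeijerenDellago1998];
  H. van Beijeren, J. R. Dorfman, H. A. Posch, Ch. Dellago, PRE 56 (1997) 5272
  [VanbeijerenEtAl1997].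
* J. Bricmont, A. Kupiainen, *High temperature expansions and dynamical systems*, CMP 178 (1996)
  [BricmontKupiainen1996]; G. Keller, *Equilibrium States in Ergodic Theory* (1998), §3.2,
  Thm. 3.3.2 [Keller1998].
-/

noncomputable section

open MeasureTheory Filter Set
open scoped ENNReal InnerProductSpace

namespace Literature.Dynamics.Billiards

open Literature.Analysis.FluidPDE Literature.Analysis.FunctionSpaces

/-! ## 1. Linearised free flight and binary collision -/

section TwoBody

variable {d : Type*} [Fintype d]

local notation "𝔼" => EuclideanSpace ℝ d

/-- The tangent map of a **free flight** of duration `τ` of one particle: the shear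
`(δx, δv) ↦ (δx + τ δv, δv)` (Gaspard 1998 (1.108)–(1.109), monodromy matrix `[[1, τ], [0, 1]]`).
[cite: Gaspard1998, §1.4.4 (1.108)–(1.109)] -/
def freeFlightTangent (τ : ℝ) : (𝔼 × 𝔼) →ₗ[ℝ] (𝔼 × 𝔼) :=
  (LinearMap.fst ℝ 𝔼 𝔼 + τ • LinearMap.snd ℝ 𝔼 𝔼).prod (LinearMap.snd ℝ 𝔼 𝔼)

omit [Fintype d] in
/-- Unfolding lemma for `freeFlightTangent`. [folklore] -/
@[simp]
theorem freeFlightTangent_apply (τ : ℝ) (ξ : 𝔼 × 𝔼) :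
    freeFlightTangent τ ξ = (ξ.1 + τ • ξ.2, ξ.2) :=
  rfl

omit [Fintype d] in
/-- A free flight of duration `0` does not move tangent vectors. [folklore] -/
theorem freeFlightTangent_zero : freeFlightTangent (d := d) 0 = LinearMap.id := by
  ext ξ <;> simp

omit [Fintype d] in
/-- Free-flight tangent maps compose additively in the duration (they form a one-parameter
group of shears). [folklore] -/
theorem freeFlightTangent_comp (σ τ : ℝ) :
    freeFlightTangent (d := d) σ ∘ₗ freeFlightTangent τ = freeFlightTangent (τ + σ) := by
  ext ξ <;> simp [add_smul, add_comm (τ • _)]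

/-- The component along `n` of a vector: `w ↦ (⟪n, w⟫ / ‖n‖²) n` (the map subtracted twice in
`reflectVel`; junk value `0` for `n = 0`). [folklore] -/
def alongLine (n : 𝔼) : 𝔼 →ₗ[ℝ] 𝔼 :=
  (‖n‖ ^ 2)⁻¹ • (innerₗ 𝔼 n).smulRight n

/-- Unfolding lemma for `alongLine`. [folklore] -/
@[simp]
theorem alongLine_apply (n w : 𝔼) : alongLine n w = (⟪n, w⟫_ℝ / ‖n‖ ^ 2) • n := by
  simp [alongLine, smul_smul, div_eq_inv_mul]

/-- The relative position perturbation `δx_p - δx_q` of a pair of tangent vectors. [folklore] -/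
def relPos : ((𝔼 × 𝔼) × (𝔼 × 𝔼)) →ₗ[ℝ] 𝔼 :=
  LinearMap.fst ℝ 𝔼 𝔼 ∘ₗ LinearMap.fst ℝ _ _ - LinearMap.fst ℝ 𝔼 𝔼 ∘ₗ LinearMap.snd ℝ _ _

/-- The relative velocity perturbation `δv_p - δv_q` of a pair of tangent vectors. [folklore] -/
def relVel : ((𝔼 × 𝔼) × (𝔼 × 𝔼)) →ₗ[ℝ] 𝔼 :=
  LinearMap.snd ℝ 𝔼 𝔼 ∘ₗ LinearMap.fst ℝ _ _ - LinearMap.snd ℝ 𝔼 𝔼 ∘ₗ LinearMap.snd ℝ _ _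

omit [Fintype d] in
/-- Unfolding lemma for `relPos`. [folklore] -/
@[simp]
theorem relPos_apply (ξ : (𝔼 × 𝔼) × (𝔼 × 𝔼)) : relPos ξ = ξ.1.1 - ξ.2.1 := rfl

omit [Fintype d] in
/-- Unfolding lemma for `relVel`. [folklore] -/
@[simp]
theorem relVel_apply (ξ : (𝔼 × 𝔼) × (𝔼 × 𝔼)) : relVel ξ = ξ.1.2 - ξ.2.2 := rfl

/-- The **displacement of the impact point**: for a relative position perturbation `δx` just
before a collision with separation `n` and incoming relative velocity `g`, the perturbed pair
touches at the shifted time `δt = -⟪n, δx⟫/⟪n, g⟫`, where the relative position has moved to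
`c = δx + δt g = δx - (⟪n, δx⟫/⟪n, g⟫) g` (tangent to the collision sphere: `⟪n, c⟫ = 0`;
Gaspard 1998 (1.110), the projection onto the tangent plane parallel to the incident velocity).
Junk value for grazing data `⟪n, g⟫ = 0` (`x/0 = 0`). [cite: Gaspard1998, §1.4.5 (1.110)] -/
def impactShift (n g : 𝔼) : 𝔼 →ₗ[ℝ] 𝔼 :=
  LinearMap.id - (⟪n, g⟫_ℝ)⁻¹ • (innerₗ 𝔼 n).smulRight g

/-- Unfolding lemma for `impactShift`. [folklore] -/
@[simp]
theorem impactShift_apply (n g w : 𝔼) :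
    impactShift n g w = w - (⟪n, w⟫_ℝ / ⟪n, g⟫_ℝ) • g := by
  simp [impactShift, smul_smul, div_eq_inv_mul]

/-- The **curvature term** of a hard-sphere collision: the velocity kick produced by the rotation
`δn̂ = c/‖n‖` of the unit normal at the displaced impact point `c`,
`c ↦ (⟪g, c⟫ n + ⟪n, g⟫ c)/‖n‖²` (`= ⟪δn̂, g⟫ n̂ + ⟪n̂, g⟫ δn̂`; Gaspard 1998 (1.112), the terms
`-2(N·V⁻) K δq - 2(V⁻·K δq) N` shared equally by two particles of equal mass).
[cite: Gaspard1998, §1.4.5 (1.112)] -/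
def curvatureKick (n g : 𝔼) : 𝔼 →ₗ[ℝ] 𝔼 :=
  (‖n‖ ^ 2)⁻¹ • ((innerₗ 𝔼 g).smulRight n + ⟪n, g⟫_ℝ • LinearMap.id)

/-- Unfolding lemma for `curvatureKick`. [folklore] -/
@[simp]
theorem curvatureKick_apply (n g c : 𝔼) :
    curvatureKick n g c = (‖n‖ ^ 2)⁻¹ • (⟪g, c⟫_ℝ • n + ⟪n, g⟫_ℝ • c) := by
  simp [curvatureKick]

/-- The **tangent map of a binary elastic collision** of two hard spheres of equal mass, seen
from the first particle `p`: input the pre-collisional tangent vectors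
`((δx_p, δv_p), (δx_q, δv_q))` (transported by free flight up to the unperturbed collision
instant), data the separation
`n = x_p - x_q` at contact (`‖n‖ = ε`) and the INCOMING relative velocity `g = v_p⁻ - v_q⁻`
(`⟪n, g⟫ < 0`); output the post-collisional tangent vector of `p` at the same instant:
`δx_p' = δx_p - P_n(δx_p - δx_q)`,
`δv_p' = δv_p - P_n(δv_p - δv_q) - curvatureKick n g (impactShift n g (δx_p - δx_q))`,
`P_n = alongLine n`. The `q`-component is `collisionTangent (-n) (-g)` applied to the swapped
pair `((δx_q, δv_q), (δx_p, δv_p))` (seen from `q` the separation and the relative velocity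
change sign). This is Gaspard 1998 (1.112) (with the position rule `δX⁺ = δX⁻ - 2(N·δX⁻)N` at fixed
time) for the billiard `‖x_p - x_q‖ ≥ ε` in `ℝ^{2d}`, `N = (n̂, -n̂)/√2`,
`K = ε⁻¹(1 - n̂n̂ᵀ)`-block; for comparison, a point particle reflected by a FIXED ball obeys the
same rule with all coefficients doubled, `δx' = δx - 2 P_n δx`,
`δv' = δv - 2 P_n δv - 2[⟪δn̂, v⟫ n̂ + ⟪n̂, v⟫ δn̂]` (the Lorentz gas).
[cite: Gaspard1998, §1.4.5 (1.112)] -/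
def collisionTangent (n g : 𝔼) : ((𝔼 × 𝔼) × (𝔼 × 𝔼)) →ₗ[ℝ] (𝔼 × 𝔼) :=
  (LinearMap.fst ℝ 𝔼 𝔼 ∘ₗ LinearMap.fst ℝ _ _ - alongLine n ∘ₗ relPos).prod
    (LinearMap.snd ℝ 𝔼 𝔼 ∘ₗ LinearMap.fst ℝ _ _ - alongLine n ∘ₗ relVel -
      curvatureKick n g ∘ₗ impactShift n g ∘ₗ relPos)

/-- The explicit formula of `collisionTangent`. [cite: Gaspard1998, §1.4.5 (1.112)] -/
theorem collisionTangent_apply (n g : 𝔼) (ξ : (𝔼 × 𝔼) × (𝔼 × 𝔼)) :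
    collisionTangent n g ξ =
      (ξ.1.1 - alongLine n (ξ.1.1 - ξ.2.1),
        ξ.1.2 - alongLine n (ξ.1.2 - ξ.2.2) -
          curvatureKick n g (impactShift n g (ξ.1.1 - ξ.2.1))) :=
  rfl

/-- With no relative perturbation (`δx_p = δx_q`, `δv_p = δv_q`: a rigid displacement of the
pair) the collision does not change the tangent vector. [folklore] -/
theorem collisionTangent_apply_diag (n g : 𝔼) (ζ : 𝔼 × 𝔼) :
    collisionTangent n g (ζ, ζ) = ζ := by
  rw [collisionTangent_apply]
  ext <;> simp

/-- **Defocusing — the clock-model factor.** A tangential offset `c ⊥ n` of the particle `p` just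
before a collision along the line of centres (incoming relative velocity `g = -a n`, so
`a = ‖g‖/ε > 0`, the partner unperturbed) leaves the collision unchanged in position and with
the diverging velocity perturbation `a c = (‖g‖/ε) c`: hard-sphere collisions are defocusing
(Gaspard 1998 §1.4.2, `K = R⁻¹ 1_⊥ ≥ 0` for a sphere of radius `R`), and `‖g‖/ε` is the growth
rate per collision of the dilute-gas clock model (van Zon–van Beijeren–Dellago 1998).
[cite: Gaspard1998, §1.4.5 (1.112)] -/
theorem collisionTangent_tangential (n c : 𝔼) (a : ℝ) (h : ⟪n, c⟫_ℝ = 0) (hn : n ≠ 0) :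
    collisionTangent n (-(a • n)) ((c, 0), (0, 0)) = (c, a • c) := by
  have hn2 : ‖n‖ ^ 2 ≠ 0 := pow_ne_zero 2 (norm_ne_zero_iff.2 hn)
  rw [collisionTangent_apply]
  ext1
  · simp [h]
  · simp [h, inner_smul_left, inner_smul_right, inner_neg_left, inner_neg_right, smul_smul]
    field_simp

omit [Fintype d] in
/-- … and over the following free flight of duration `τ` the offset grows by the clock-model factor
`1 + ‖g‖ τ / ε`: `(c, a c) ↦ ((1 + τ a) c, a c)` — the factor `1 + ‖g‖ τ⁺` (at `ε = 1`) whose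
logarithm `clockCharge` sums.
[cite: VanzonVanbeijerenDellago1998, clock model (growth factor |g|τ/a per collision)] -/
theorem freeFlightTangent_clock (τ a : ℝ) (c : 𝔼) :
    freeFlightTangent τ (c, a • c) = ((1 + τ * a) • c, a • c) := by
  ext1
  · simp [add_smul, smul_smul]
  · simp

end TwoBody

/-! ## 2. The frozen-exterior tangent map of finitely many tagged particles -/

section Tagged

variable {d : Type*} [Fintype d]

local notation "𝔼" => EuclideanSpace ℝ d

/-- Free flight of duration `τ` of all tagged particles: the shear `freeFlightTangent τ` in each
component. [cite: Gaspard1998, §1.4.4 (1.108)] -/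
def piFreeFlight (I : Finset (𝔼 × 𝔼)) (τ : ℝ) : (I → 𝔼 × 𝔼) →ₗ[ℝ] (I → 𝔼 × 𝔼) :=
  LinearMap.pi fun p => freeFlightTangent τ ∘ₗ LinearMap.proj p

omit [Fintype d] in
/-- Unfolding lemma for `piFreeFlight`. [folklore] -/
@[simp]
theorem piFreeFlight_apply (I : Finset (𝔼 × 𝔼)) (τ : ℝ) (ξ : I → 𝔼 × 𝔼) (p : I) :
    piFreeFlight I τ ξ p = ((ξ p).1 + τ • (ξ p).2, (ξ p).2) :=
  rfl

open Classical in
/-- The **collision map at the instant `s`** of the tagged particles `I` along the particle paths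
`x` (labels `S`, diameter `ε`), exterior frozen: a tagged particle `p` with a collision event at
time `s` (`(p, s) ∈ collisionEvents ε S x`, partner `q` — unique by
`IsInfiniteHardSphereTrajectory.binary`) is updated by `collisionTangent n g` applied to its own
tangent vector and to the partner's (the partner's if `q ∈ I`, ZERO if `q` is untagged), with
`n = x_p(s) - x_q(s)` and the incoming relative velocity `g` recovered from the outgoing
(right-continuous) velocities by the involution `reflectVel n`; particles without an event at `s`
are unchanged. Disjoint pairs colliding at the same instant are treated simultaneously.
[cite: Gaspard1998, §1.4.5 (1.112)] -/
def instantTangent (ε : ℝ) (S : Set (𝔼 × 𝔼)) (x : 𝔼 × 𝔼 → ℝ → 𝔼 × 𝔼) (I : Finset (𝔼 × 𝔼))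
    (s : ℝ) : (I → 𝔼 × 𝔼) →ₗ[ℝ] (I → 𝔼 × 𝔼) :=
  LinearMap.pi fun p : I =>
    if h : ((p : 𝔼 × 𝔼), s) ∈ collisionEvents ε S x then
      collisionTangent ((x p s).1 - (x (Classical.choose h.2) s).1)
          ((reflectVel ((x p s).1 - (x (Classical.choose h.2) s).1)
              ((x p s).2, (x (Classical.choose h.2) s).2)).1 -
            (reflectVel ((x p s).1 - (x (Classical.choose h.2) s).1)
              ((x p s).2, (x (Classical.choose h.2) s).2)).2) ∘ₗ
        ((LinearMap.proj p).prod
          (if hq : Classical.choose h.2 ∈ I then LinearMap.proj (⟨Classical.choose h.2, hq⟩ : I)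
            else 0))
    else LinearMap.proj p

/-- A tagged particle without a collision event at the instant `s` keeps its tangent vector.
[folklore] -/
theorem instantTangent_apply_of_notMem {ε : ℝ} {S : Set (𝔼 × 𝔼)} {x : 𝔼 × 𝔼 → ℝ → 𝔼 × 𝔼}
    {I : Finset (𝔼 × 𝔼)} {s : ℝ} (ξ : I → 𝔼 × 𝔼) {p : I}
    (h : ((p : 𝔼 × 𝔼), s) ∉ collisionEvents ε S x) : instantTangent ε S x I s ξ p = ξ p := by
  classical
  simp [instantTangent, h]

/-- The **collision instants** in `(0, t]` of the tagged particles `I` along the paths `x`.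
[folklore] -/
def collisionInstants (ε : ℝ) (S : Set (𝔼 × 𝔼)) (x : 𝔼 × 𝔼 → ℝ → 𝔼 × 𝔼) (I : Finset (𝔼 × 𝔼))
    (t : ℝ) : Set ℝ :=
  {s | s ∈ Ioc 0 t ∧ ∃ p ∈ I, (p, s) ∈ collisionEvents ε S x}

/-- Membership in the set of collision instants. [folklore] -/
theorem mem_collisionInstants {ε : ℝ} {S : Set (𝔼 × 𝔼)} {x : 𝔼 × 𝔼 → ℝ → 𝔼 × 𝔼}
    {I : Finset (𝔼 × 𝔼)} {t s : ℝ} :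
    s ∈ collisionInstants ε S x I t ↔ s ∈ Ioc 0 t ∧ ∃ p ∈ I, (p, s) ∈ collisionEvents ε S x :=
  Iff.rfl

/-- Time-ordered accumulation of the tangent map along an (ascending) list of collision instants:
the state `(s₀, A)` (time reached, map so far) is advanced to the instant `s` by the free flight
`s - s₀` followed by the collision map at `s`. [folklore] -/
def accumulateTangent (ε : ℝ) (S : Set (𝔼 × 𝔼)) (x : 𝔼 × 𝔼 → ℝ → 𝔼 × 𝔼) (I : Finset (𝔼 × 𝔼))
    (l : List ℝ) (init : ℝ × ((I → 𝔼 × 𝔼) →ₗ[ℝ] (I → 𝔼 × 𝔼))) :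
    ℝ × ((I → 𝔼 × 𝔼) →ₗ[ℝ] (I → 𝔼 × 𝔼)) :=
  l.foldl (fun acc s => (s, instantTangent ε S x I s ∘ₗ piFreeFlight I (s - acc.1) ∘ₗ acc.2)) init

/-- With no instant left the accumulated map is unchanged. [folklore] -/
@[simp]
theorem accumulateTangent_nil (ε : ℝ) (S : Set (𝔼 × 𝔼)) (x : 𝔼 × 𝔼 → ℝ → 𝔼 × 𝔼)
    (I : Finset (𝔼 × 𝔼)) (init : ℝ × ((I → 𝔼 × 𝔼) →ₗ[ℝ] (I → 𝔼 × 𝔼))) :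
    accumulateTangent ε S x I [] init = init :=
  rfl

open Classical in
/-- The **frozen-exterior tangent map** over the time interval `[0, t]` of the tagged particles
`I` along the particle paths `x` (labels `S`, sphere diameter `ε`): the derivative, at zero
perturbation, of the motion of the tagged particles when their initial phase points are displaced
and every other particle is held to its given path — the time-ordered product over the collision
instants `s₁ < ⋯ < s_k` of tagged particles in `(0, t]` of free flights and collision maps,
`F_{t - s_k} C_{s_k} F_{s_k - s_{k-1}} ⋯ C_{s₁} F_{s₁}` (Gaspard 1998 (1.106): monodromy matrix as a
product of free-flight and collision matrices). Junk value `0` if there are infinitely many such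
instants (impossible for an infinite hard-sphere trajectory, whose tagged particles stay in a
bounded region during `[0, t]`, by `IsInfiniteHardSphereTrajectory.locFinite`).
[cite: Gaspard1998, §1.4.3 (1.106)] -/
def taggedTangentMap (ε : ℝ) (S : Set (𝔼 × 𝔼)) (x : 𝔼 × 𝔼 → ℝ → 𝔼 × 𝔼) (I : Finset (𝔼 × 𝔼))
    (t : ℝ) : (I → 𝔼 × 𝔼) →ₗ[ℝ] (I → 𝔼 × 𝔼) :=
  if h : (collisionInstants ε S x I t).Finite then
    piFreeFlight I
        (t - (accumulateTangent ε S x I (h.toFinset.sort (· ≤ ·)) (0, LinearMap.id)).1) ∘ₗ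
      (accumulateTangent ε S x I (h.toFinset.sort (· ≤ ·)) (0, LinearMap.id)).2
  else 0

open Classical in
/-- **Collision-free tagged particles fly freely**: if no tagged particle collides during
`(0, t]`, the tangent map is the free-flight shear of duration `t`. [folklore] -/
theorem taggedTangentMap_of_isEmpty {ε : ℝ} {S : Set (𝔼 × 𝔼)} {x : 𝔼 × 𝔼 → ℝ → 𝔼 × 𝔼}
    {I : Finset (𝔼 × 𝔼)} {t : ℝ} (h : collisionInstants ε S x I t = ∅) :
    taggedTangentMap ε S x I t = piFreeFlight I t := by
  have hfin : (collisionInstants ε S x I t).Finite := by rw [h]; exact finite_empty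
  have hsort : hfin.toFinset.sort (· ≤ ·) = [] := by
    have : hfin.toFinset = ∅ := by simp [h]
    rw [this, Finset.sort_empty]
  rw [taggedTangentMap, dif_pos hfin, hsort, accumulateTangent_nil, sub_zero]
  rfl

end Tagged

/-! ## 3. Logarithmic volume growth of a linear map -/

section Growth

variable {m : Type*} [Fintype m] [DecidableEq m]

/-- The **logarithmic volume growth** `∑ᵢ log⁺ sᵢ(A) ∈ [0, ∞]` of a real square matrix: the sum of
the logarithms of its singular values exceeding `1`, written as `½ ∑ᵢ log⁺` of the eigenvalues of
the positive semidefinite matrix `Aᴴ A` (`Matrix.IsHermitian.eigenvalues`; `ENNReal.ofReal` discards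
the negative logarithms). It is the largest logarithmic expansion of volume by `A` over all linear
subspaces; along the derivative cocycle `A = D f^n (x)` of a Lyapunov–Perron regular point,
`n⁻¹ ∑ᵢ log⁺ sᵢ → ∑_{χᵢ > 0} kᵢ χᵢ`, the sum of the positive Lyapunov exponents with multiplicity
(Barreira–Pesin 2023 §2.1.2 (2.3), Thm. 3.12 (a)–(c): growth rates of `k`-volumes), the integrand
of Ruelle's inequality (Thm. 9.22). [cite: BarreiraPesin2023, §2.1.2 (2.3), Thm. 3.12, Thm. 9.22] -/
def logVolGrowth (A : Matrix m m ℝ) : ℝ≥0∞ :=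
  ∑ i, ENNReal.ofReal (Real.log ((Matrix.isHermitian_conjTranspose_mul_self A).eigenvalues i) / 2)

/-- Unfolding lemma for `logVolGrowth`. [folklore] -/
theorem logVolGrowth_def (A : Matrix m m ℝ) :
    logVolGrowth A = ∑ i, ENNReal.ofReal
      (Real.log ((Matrix.isHermitian_conjTranspose_mul_self A).eigenvalues i) / 2) :=
  rfl

/-- The zero map expands no volume. [folklore] -/
theorem logVolGrowth_zero : logVolGrowth (0 : Matrix m m ℝ) = 0 := by
  have h : (Matrix.isHermitian_conjTranspose_mul_self (0 : Matrix m m ℝ)).eigenvalues = 0 :=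
    (Matrix.IsHermitian.eigenvalues_eq_zero_iff _).2 (by simp)
  have h' : ∀ i, (Matrix.isHermitian_conjTranspose_mul_self (0 : Matrix m m ℝ)).eigenvalues i = 0 :=
    fun i => congrFun h i
  simp only [logVolGrowth, h', Real.log_zero, zero_div, ENNReal.ofReal_zero, Finset.sum_const_zero]

variable {d : Type*} [Fintype d] [DecidableEq d]

local notation "𝔼" => EuclideanSpace ℝ d

/-- The coordinate basis `(δxᵢ, δvᵢ)_{i ∈ I}` of the tagged tangent space `I → ℝ^d × ℝ^d` (standard
bases of `EuclideanSpace ℝ d` in each factor). [folklore] -/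
def tangentBasis (I : Type*) [Fintype I] : Module.Basis (Σ _ : I, d ⊕ d) ℝ (I → 𝔼 × 𝔼) :=
  Pi.basis fun _ => (EuclideanSpace.basisFun d ℝ).toBasis.prod (EuclideanSpace.basisFun d ℝ).toBasis

/-- The logarithmic volume growth `∑ log⁺ sᵢ` of a linear map of the tagged tangent space, singular
values taken in the Euclidean structure of the coordinates `(δxᵢ, δvᵢ)ᵢ` (`tangentBasis`).
[cite: BarreiraPesin2023, §2.1.2 (2.3), Thm. 3.12, Thm. 9.22] -/
def linGrowth {I : Type*} [Fintype I] [DecidableEq I] (M : (I → 𝔼 × 𝔼) →ₗ[ℝ] (I → 𝔼 × 𝔼)) :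
    ℝ≥0∞ :=
  logVolGrowth (LinearMap.toMatrix (tangentBasis I) (tangentBasis I) M)

/-- The zero map of the tagged tangent space expands no volume. [folklore] -/
theorem linGrowth_zero {I : Type*} [Fintype I] [DecidableEq I] :
    linGrowth (0 : (I → 𝔼 × 𝔼) →ₗ[ℝ] (I → 𝔼 × 𝔼)) = 0 := by
  rw [linGrowth, map_zero, logVolGrowth_zero]

/-- With no tagged particle there is nothing to expand. [folklore] -/
theorem linGrowth_of_isEmpty {I : Type*} [Fintype I] [DecidableEq I] [IsEmpty I]
    (M : (I → 𝔼 × 𝔼) →ₗ[ℝ] (I → 𝔼 × 𝔼)) : linGrowth M = 0 := by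
  rw [linGrowth, logVolGrowth]
  exact Finset.sum_eq_zero fun i _ => isEmptyElim i.1

end Growth

/-! ## 4. The positive-Lyapunov density of a law of the infinite gas -/

section Infinite

variable {d : Type*} [Fintype d] [DecidableEq d] {ε : ℝ}

local notation "𝔼" => EuclideanSpace ℝ d

/-- The half-open cube `[0, L)^d` of side `L` at the origin (`cube 1 = Torus.unitCube d`).
[folklore] -/
def cube (L : ℝ) : Set 𝔼 :=
  {y | ∀ i, y i ∈ Ico (0 : ℝ) L}

omit [Fintype d] [DecidableEq d] in
/-- Membership in `cube L`. [folklore] -/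
theorem mem_cube {L : ℝ} {y : 𝔼} : y ∈ cube L ↔ ∀ i, y i ∈ Ico (0 : ℝ) L :=
  Iff.rfl

omit [Fintype d] [DecidableEq d] in
/-- The unit cube of the tree is `cube 1`. [folklore] -/
theorem cube_one : cube (d := d) 1 = Torus.unitCube d :=
  rfl

open Classical in
/-- The **finite-time volume growth of a window**: `∑ log⁺ sᵢ` of the frozen-exterior tangent map
over `[0, t]` of the particles of the configuration `ω` with initial position in the window `B`,
along the paths `Φ.traj ω` of the infinite hard-sphere flow. Junk value `⊤` if infinitely many
particles start in `B` (impossible for a hard-sphere configuration and a bounded window,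
`PosLocallyFinite.finite_particlesIn`). [folklore] -/
def finiteTimeGrowth (Φ : InfiniteHardSphereFlow d ε) (ω : PointConfig (𝔼 × 𝔼)) (B : Set 𝔼)
    (t : ℝ) : ℝ≥0∞ :=
  if h : (particlesIn ω B).Finite then
    linGrowth (taggedTangentMap ε (ω : Set (𝔼 × 𝔼)) (Φ.traj ω) h.toFinset t)
  else ⊤

/-- The **growth density at time `t`**: the upper density per unit volume, along the cubes
`[0, L)^d`, `L → ∞`, of the finite-time volume growth — the thermodynamic limit taken at FIXED time
(module docstring, *Order of limits*). [folklore] -/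
def growthDensity (Φ : InfiniteHardSphereFlow d ε) (ω : PointConfig (𝔼 × 𝔼)) (t : ℝ) : ℝ≥0∞ :=
  limsup (fun L : ℕ => finiteTimeGrowth Φ ω (cube ((L : ℝ) + 1)) t /
    ((L : ℝ≥0∞) + 1) ^ Fintype.card d) atTop

/-- The **pathwise positive-Lyapunov density** `λ⁺(ω) ∈ [0, ∞]` of a configuration of the infinite
gas: `inf_{n ≥ 1} n⁻¹ · growthDensity Φ ω n` — volume growth per unit volume per unit time along
the orbit of `ω`, the infinite-volume counterpart of `∑_{χᵢ > 0} kᵢ χᵢ (x)` (Barreira–Pesin 2023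
Thm. 9.22; `inf` as for `Ergodic.dynEntropy`). [folklore] -/
def posLyapAt (Φ : InfiniteHardSphereFlow d ε) (ω : PointConfig (𝔼 × 𝔼)) : ℝ≥0∞ :=
  ⨅ n : ℕ, growthDensity Φ ω ((n : ℝ) + 1) / ((n : ℝ≥0∞) + 1)

/-- The **positive-Lyapunov (unstable-Jacobian) density** `λ⁺(P) = ∫ λ⁺(ω) P(dω) ∈ [0, ∞]` of a
law `P` on configurations of the infinite hard-sphere gas evolving under `Φ`: sum of the positive
Lyapunov exponents per unit time per unit volume (lower Lebesgue integral of `posLyapAt`; intended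
for `P` translation invariant, `Φ.IsAEDefined P`, `Φ.IsStationary P`). The right-hand side of the
would-be density Ruelle inequality / Pesin formula `h(P) ≤ λ⁺(P)` of the infinite gas
(`entropyDensity`; Sinai–Chernov 1982/1986 for the equilibrium gas, as quoted by Wojtkowski 1988,
p. 133), neither of which is asserted here. [folklore] -/
def posLyapDensity (Φ : InfiniteHardSphereFlow d ε) (P : Measure (PointConfig (𝔼 × 𝔼))) : ℝ≥0∞ :=
  ∫⁻ ω, posLyapAt Φ ω ∂P

/-- Unfolding lemma for `posLyapDensity`. [folklore] -/
theorem posLyapDensity_def (Φ : InfiniteHardSphereFlow d ε) (P : Measure (PointConfig (𝔼 × 𝔼))) :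
    posLyapDensity Φ P = ∫⁻ ω, posLyapAt Φ ω ∂P :=
  rfl

/-- **H4 for `λ⁺`, additivity**: the positive-Lyapunov density of a sum of laws is the sum of
the densities. [folklore] -/
theorem posLyapDensity_add_measure (Φ : InfiniteHardSphereFlow d ε)
    (P Q : Measure (PointConfig (𝔼 × 𝔼))) :
    posLyapDensity Φ (P + Q) = posLyapDensity Φ P + posLyapDensity Φ Q :=
  lintegral_add_measure _ _ _

/-- **H4 for `λ⁺`, homogeneity**: the positive-Lyapunov density of a multiple of a law.
[folklore] -/
theorem posLyapDensity_smul_measure (Φ : InfiniteHardSphereFlow d ε) (c : ℝ≥0∞)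
    (P : Measure (PointConfig (𝔼 × 𝔼))) :
    posLyapDensity Φ (c • P) = c * posLyapDensity Φ P :=
  lintegral_smul_measure _ _

/-- The zero measure has zero positive-Lyapunov density. [folklore] -/
@[simp]
theorem posLyapDensity_zero_measure (Φ : InfiniteHardSphereFlow d ε) :
    posLyapDensity Φ (0 : Measure (PointConfig (𝔼 × 𝔼))) = 0 :=
  lintegral_zero_measure _

omit [Fintype d] [DecidableEq d] in
/-- The empty configuration has no particle in any window. [folklore] -/
theorem particlesIn_empty (B : Set 𝔼) : particlesIn (∅ : PointConfig (𝔼 × 𝔼)) B = ∅ :=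
  eq_empty_of_forall_notMem fun p hp =>
    absurd (show p ∈ (∅ : PointConfig (𝔼 × 𝔼)).carrier from hp.1) (by simp)

/-- **The vacuum expands nothing**: every window of the empty configuration has zero finite-time
growth. [folklore] -/
theorem finiteTimeGrowth_empty (Φ : InfiniteHardSphereFlow d ε) (B : Set 𝔼) (t : ℝ) :
    finiteTimeGrowth Φ (∅ : PointConfig (𝔼 × 𝔼)) B t = 0 := by
  classical
  have hfin : (particlesIn (∅ : PointConfig (𝔼 × 𝔼)) B).Finite := by
    rw [particlesIn_empty]; exact finite_empty
  rw [finiteTimeGrowth, dif_pos hfin]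
  haveI : IsEmpty hfin.toFinset :=
    ⟨fun p => absurd ((particlesIn_empty B).subset (hfin.mem_toFinset.1 p.2)) (notMem_empty _)⟩
  exact linGrowth_of_isEmpty _

/-- The vacuum has zero growth density at every time. [folklore] -/
theorem growthDensity_empty (Φ : InfiniteHardSphereFlow d ε) (t : ℝ) :
    growthDensity Φ (∅ : PointConfig (𝔼 × 𝔼)) t = 0 := by
  simp only [growthDensity, finiteTimeGrowth_empty, ENNReal.zero_div]
  exact limsup_const 0

/-- **The vacuum has zero positive-Lyapunov density.** [folklore] -/
theorem posLyapAt_empty (Φ : InfiniteHardSphereFlow d ε) :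
    posLyapAt Φ (∅ : PointConfig (𝔼 × 𝔼)) = 0 := by
  refine le_antisymm (iInf_le_of_le 0 ?_) bot_le
  simp [growthDensity_empty]

/-! ## 5. The collision-charge (clock) density -/

omit [DecidableEq d] in
/-- The **gap to the next collision of either partner**: for particles `p`, `q` (colliding at
time `t`), the infimum of the `τ > 0` such that `p` or `q` has a collision event at time `t + τ`
(`sInf`, hence the junk value `0` — no charge below — if neither ever collides again).
[folklore] -/
def nextCollisionGap (ε : ℝ) (S : Set (𝔼 × 𝔼)) (x : 𝔼 × 𝔼 → ℝ → 𝔼 × 𝔼) (p q : 𝔼 × 𝔼)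
    (t : ℝ) : ℝ :=
  sInf {τ : ℝ | 0 < τ ∧ ((p, t + τ) ∈ collisionEvents ε S x ∨ (q, t + τ) ∈ collisionEvents ε S x)}

omit [DecidableEq d] in
/-- The **charge of a collision event** `e = (p, t)`: `log (1 + ‖g‖ τ⁺)` with `g = v_p(t) - v_q(t)`
the relative velocity of `p` and its partner `q` at the collision (its norm is the same before and
after) and `τ⁺ = nextCollisionGap` — the logarithmic growth `‖δv'‖/‖δv‖ ≈ ‖g‖ τ / ε` per collision
of the dilute-gas clock model at `ε = 1` (van Zon–van Beijeren–Dellago 1998), the summand of the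
charge `Λ` of crux `UpperVolumeLemma` of route PesinPricing. Written as a `⨆` over the partners of
the event (there is exactly one on an infinite hard-sphere trajectory; `0` for a non-event).
[cite: VanzonVanbeijerenDellago1998, clock model (growth factor |g|τ/a per collision)] -/
def eventCharge (ε : ℝ) (S : Set (𝔼 × 𝔼)) (x : 𝔼 × 𝔼 → ℝ → 𝔼 × 𝔼) (e : (𝔼 × 𝔼) × ℝ) :
    ℝ≥0∞ :=
  ⨆ (q : 𝔼 × 𝔼) (_ : q ∈ S ∧ q ≠ e.1 ∧ ‖(x e.1 e.2).1 - (x q e.2).1‖ = ε),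
    ENNReal.ofReal
      (Real.log (1 + ‖(x e.1 e.2).2 - (x q e.2).2‖ * nextCollisionGap ε S x e.1 q e.2))

/-- The **collision charge of a configuration** in unit time and unit volume: the sum of the event
charges over the collision events `(p, s)` of `ω` along `Φ.traj ω` with `s ∈ [0, 1)` and position
`x_p(s)` in the unit cube `[0,1)^d` (two events per binary collision, one per partner — the
convention of `collisionIntensity`; unconditional sum in `[0, ∞]`). [folklore] -/
def clockCharge (Φ : InfiniteHardSphereFlow d ε) (ω : PointConfig (𝔼 × 𝔼)) : ℝ≥0∞ :=
  ∑' e : ↥(collisionEvents ε (ω : Set (𝔼 × 𝔼)) (Φ.traj ω) ∩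
      {e | e.2 ∈ Ico (0 : ℝ) 1 ∧ (Φ.traj ω e.1 e.2).1 ∈ Torus.unitCube d}),
    eventCharge ε (ω : Set (𝔼 × 𝔼)) (Φ.traj ω) e

/-- The **collision-charge (clock) density** `∫ clockCharge dP ∈ [0, ∞]` of a law `P`: expected
charge `∑ log (1 + ‖g‖ τ⁺)` of the collisions per unit time per unit volume — the density form of
the charge `Λ` of crux `UpperVolumeLemma` (route PesinPricing) at unit diameter. Dividing by
`intensity P` gives the charge per particle per unit time. No comparison with `posLyapDensity` is
claimed. [folklore] -/
def clockChargeDensity (Φ : InfiniteHardSphereFlow d ε) (P : Measure (PointConfig (𝔼 × 𝔼))) :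
    ℝ≥0∞ :=
  ∫⁻ ω, clockCharge Φ ω ∂P

omit [DecidableEq d] in
/-- The collision-charge density is additive in the law. [folklore] -/
theorem clockChargeDensity_add_measure (Φ : InfiniteHardSphereFlow d ε)
    (P Q : Measure (PointConfig (𝔼 × 𝔼))) :
    clockChargeDensity Φ (P + Q) = clockChargeDensity Φ P + clockChargeDensity Φ Q :=
  lintegral_add_measure _ _ _

/-! ## 6. Pesin defect: per unit volume and per particle -/

/-- The **Pesin-defect density** `λ⁺(P) - h(P) ∈ [0, ∞]` (per unit time per unit volume) of a law
`P` of the infinite gas under `Φ`: positive-Lyapunov density minus space-time entropy density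
`entropyDensity` (truncated subtraction in `ℝ≥0∞`: `0` if `λ⁺ ≤ h`, and `∞ - ∞ = 0`), the
infinite-volume counterpart of `pesinDefect` of the finite file; the laws with zero defect are the
would-be "measures satisfying Pesin's entropy formula" (Ledrappier–Young 1985) of the infinite gas.
[folklore] -/
def pesinDefectDensity (Φ : InfiniteHardSphereFlow d ε) (P : Measure (PointConfig (𝔼 × 𝔼))) :
    ℝ≥0∞ :=
  posLyapDensity Φ P - entropyDensity Φ P

/-- Unfolding lemma for `pesinDefectDensity`. [folklore] -/
theorem pesinDefectDensity_def (Φ : InfiniteHardSphereFlow d ε)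
    (P : Measure (PointConfig (𝔼 × 𝔼))) :
    pesinDefectDensity Φ P = posLyapDensity Φ P - entropyDensity Φ P :=
  rfl

/-- A law whose entropy density dominates its positive-Lyapunov density has zero defect density.
[folklore] -/
theorem pesinDefectDensity_eq_zero_of_le {Φ : InfiniteHardSphereFlow d ε}
    {P : Measure (PointConfig (𝔼 × 𝔼))} (h : posLyapDensity Φ P ≤ entropyDensity Φ P) :
    pesinDefectDensity Φ P = 0 :=
  tsub_eq_zero_of_le h

/-- Under the density Ruelle inequality `h(P) ≤ λ⁺(P)` the defect density is the honest
difference: `h + defect = λ⁺`. [folklore] -/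
theorem entropyDensity_add_pesinDefectDensity {Φ : InfiniteHardSphereFlow d ε}
    {P : Measure (PointConfig (𝔼 × 𝔼))} (h : entropyDensity Φ P ≤ posLyapDensity Φ P) :
    entropyDensity Φ P + pesinDefectDensity Φ P = posLyapDensity Φ P :=
  add_tsub_cancel_of_le h

/-- The **Pesin defect per particle per unit (microscopic) time** `i(P) = (λ⁺(P) - h(P)) / ρ(P)`,
`ρ = intensity`: the rate of cruxes `KiferYoungUpperR` / `PesinSaturationRigidity` of route
PesinPricing (there for `Φ : InfiniteHardSphereFlow (Fin 3) 1` and translation-invariant stationary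
`P` of finite intensity and kinetic energy density). `ℝ≥0∞` conventions: `i = 0` iff
`λ⁺ ≤ h` or `ρ = ∞` (`infPesinDefect_eq_zero_iff`), and `i = ∞` if `λ⁺ > h` with `ρ = 0`. For the
`ε⁻¹`-blow-up of the periodised `(N+1)`-sphere system at the Euler scaling this is
`σ · pesinDefectPerCollision` (module docstring, item 6). [folklore] -/
def infPesinDefect (Φ : InfiniteHardSphereFlow d ε) (P : Measure (PointConfig (𝔼 × 𝔼))) : ℝ≥0∞ :=
  pesinDefectDensity Φ P / intensity P

/-- Unfolding lemma for `infPesinDefect`. [folklore] -/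
theorem infPesinDefect_def (Φ : InfiniteHardSphereFlow d ε) (P : Measure (PointConfig (𝔼 × 𝔼))) :
    infPesinDefect Φ P = (posLyapDensity Φ P - entropyDensity Φ P) / intensity P :=
  rfl

/-- **When is a law Pesin-saturating?** `i(P) = 0` iff `λ⁺(P) ≤ h(P)` or the intensity is infinite
(the second alternative is the `x / ∞ = 0` convention and is excluded by the finite-intensity
hypothesis of the cruxes). [folklore] -/
theorem infPesinDefect_eq_zero_iff (Φ : InfiniteHardSphereFlow d ε)
    (P : Measure (PointConfig (𝔼 × 𝔼))) :
    infPesinDefect Φ P = 0 ↔ posLyapDensity Φ P ≤ entropyDensity Φ P ∨ intensity P = ∞ := by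
  rw [infPesinDefect, pesinDefectDensity, ENNReal.div_eq_zero_iff, tsub_eq_zero_iff_le]

/-- A law whose entropy density dominates its positive-Lyapunov density is Pesin-saturating.
[folklore] -/
theorem infPesinDefect_eq_zero_of_le {Φ : InfiniteHardSphereFlow d ε}
    {P : Measure (PointConfig (𝔼 × 𝔼))} (h : posLyapDensity Φ P ≤ entropyDensity Φ P) :
    infPesinDefect Φ P = 0 :=
  (infPesinDefect_eq_zero_iff Φ P).2 (Or.inl h)

end Infinite

end Literature.Dynamics.Billiards

end
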